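import Literature.Combinatorics.SimpleGraph.HamiltonianLOTFamilies2
import HarnessLib

/-!
# The `#3SAT → #HamPath` construction, IV: the count, down to chain states

Continuation of `HamiltonianLOTFamilies2.lean`. The graph of `φ` is
`graph₂ φ = graphUpTo (graph₁ φ) (verts₁ φ) (fam₂ φ) (n₂ φ)` on `verts₂ φ`. This file expands its
number of Hamiltonian `0 – (5M-1)` paths by the substitution theorems (stage 2 unrefined, stage 1
refined — the stage-2 hop slots are inner edges of the stage-1 diamond ladders) and the count of
the diamond chain (`hamCountRF_chain_eq_card`), and collapses the resulting double sum over slot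
sets: **for each chain state `σ` at most one pair of slot sets contributes**, namely the sets of
slots the path of `σ` uses (`U₁of`, `U₂of`; the hop part of `U₂of` is forced by the exclusive-or
hop ladders and the consistency of the diamond ladders). Main result:

* `hamCount_graph₂_eq_card` — `hamCount (graph₂ φ) (verts₂ φ) 0 (5 M - 1) = #{σ | Φ₁ φ σ}`, where
  `Φ₁ φ σ` says that the canonical slot sets of `σ` pass every gadget's census.

Part V evaluates `Φ₁` cell by cell and counts `2 · #SAT(φ)`.

## References

* M. Liśkiewicz, M. Ogihara, S. Toda, TCS 304 (2003) 129–156, §3 (Lemma 4).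
* M. R. Garey, D. S. Johnson, *Computers and Intractability*, Freeman 1979, §3.2.2.
-/

namespace Literature.Combinatorics.SimpleGraph

namespace LOTReduction

open Literature.Computability.Complexity Finset

variable (φ : CNF ℕ)

/-! ### The final graph and the slot sets -/

/-- **The graph of `φ`.** [cite: LiskiewiczOgiharaToda2003, §3] -/
noncomputable def graph₂ : _root_.SimpleGraph ℕ :=
  GadgetFamily.graphUpTo (graph₁ φ) (verts₁ φ) (fam₂ φ) (n₂ φ)

/-- **Its vertex set.** [folklore] -/
noncomputable def verts₂ : Finset ℕ :=
  GadgetFamily.vertsUpTo (verts₁ φ) (fam₂ φ) (n₂ φ)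

/-- All stage-1 slots. [folklore] -/
noncomputable def SB₁ : Finset (ℕ × ℕ) :=
  GadgetFamily.slotsBelow (fam₁ φ) (n₁ φ)

/-- All stage-2 slots. [folklore] -/
noncomputable def SB₂ : Finset (ℕ × ℕ) :=
  GadgetFamily.slotsBelow (fam₂ φ) (n₂ φ)

/-- **Hop slots**: first end at or above `base1` (the others are chain slot edges). [folklore] -/
def IsHop (e : ℕ × ℕ) : Prop := base1 φ ≤ e.1

/-- Decidability (for the counting arguments). [folklore] -/
instance (e : ℕ × ℕ) : Decidable (IsHop φ e) := by unfold IsHop; infer_instance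

variable {φ}

/-- Membership in `SB₂`. [folklore] -/
theorem mem_SB₂ {e : ℕ × ℕ} : e ∈ SB₂ φ ↔ ∃ i < n₂ φ, e ∈ (placed₂ φ i).S :=
  GadgetFamily.mem_slotsBelow_iff

/-- Membership in `SB₁`. [folklore] -/
theorem mem_SB₁ {e : ℕ × ℕ} : e ∈ SB₁ φ ↔ ∃ i < n₁ φ, e ∈ (placed₁ φ i).S :=
  GadgetFamily.mem_slotsBelow_iff

/-! ### Stage-2 gadgets: no offered edges, census `[|U| = 1]` -/

/-- Stage-2 gadgets offer no inner edges. [folklore] -/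
theorem placed₂_H {i : ℕ} (hi : i < n₂ φ) : (placed₂ φ i).H = ∅ := by
  unfold placed₂; rw [dif_pos hi]; rfl

/-- The census specification of a stage-2 gadget: exactly one slot used. [folklore] -/
theorem placed₂_spec {i : ℕ} (hi : i < n₂ φ) (U RX : Finset (ℕ × ℕ)) : (placed₂ φ i).spec U RX ↔ U.card = 1 := by
  unfold placed₂; rw [dif_pos hi]; exact Iff.rfl

/-- **The census of a stage-2 gadget.** [cite: LiskiewiczOgiharaToda2003, §3 (XOR-gadget)] -/
theorem coverCount₂_eq {i : ℕ} (hi : i < n₂ φ) (U₂ : Finset (ℕ × ℕ)) :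
    coverCount (placed₂ φ i).GX (placed₂ φ i).VX (U₂ ∩ (placed₂ φ i).S) =
      if (U₂ ∩ (placed₂ φ i).S).card = 1 then 1 else 0 := by
  have h := (placed₂ φ i).census (U₂ ∩ (placed₂ φ i).S) inter_subset_right ∅ (empty_subset _)
  rw [placed₂_H hi, Finset.empty_sdiff, coverCountRF_empty] at h
  rw [h]
  by_cases hc : (U₂ ∩ (placed₂ φ i).S).card = 1
  · rw [if_pos hc, if_pos ((placed₂_spec hi _ _).2 hc)]
  · rw [if_neg hc, if_neg (fun h' => hc ((placed₂_spec hi _ _).1 h'))]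

variable (φ) in
/-- **All stage-2 censuses pass**: every exclusive-or ladder has exactly one used slot. [folklore] -/
def A₂ (U₂ : Finset (ℕ × ℕ)) : Prop :=
  ∀ i ∈ range (n₂ φ), (U₂ ∩ (placed₂ φ i).S).card = 1

/-- Decidability (for the counting arguments). [folklore] -/
noncomputable instance (U₂ : Finset (ℕ × ℕ)) : Decidable (A₂ φ U₂) := by unfold A₂; infer_instance

/-- The product of the stage-2 censuses is the indicator of `A₂`. [folklore] -/
theorem prod₂_eq (U₂ : Finset (ℕ × ℕ)) :
    ∏ i ∈ range (n₂ φ), coverCount ((fam₂ φ).GX i) ((fam₂ φ).VX i) (U₂ ∩ (fam₂ φ).S i) = if A₂ φ U₂ then 1 else 0 := by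
  show ∏ i ∈ range (n₂ φ), coverCount (placed₂ φ i).GX (placed₂ φ i).VX (U₂ ∩ (placed₂ φ i).S) = _
  rw [prod_congr rfl fun i hi => coverCount₂_eq (mem_range.1 hi) U₂, prod_boole]
  unfold A₂
  split_ifs <;> rfl

/-! ### The stage-2 slots: hop slots of a site -/

/-- The slots of the hop ladders of column `c`, row `r`. [folklore] -/
theorem slotPair₂_hop {c r h : ℕ} (hc : c < N φ) (hr : r < N φ) (hh : h < 5) :
    slotPair₂ φ (5 * (c * N φ + r) + h) = hopSlots' φ c r h ∧ 5 * (c * N φ + r) + h < n₂ φ := by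
  have hlt : c * N φ + r < N φ * N φ := by
    calc c * N φ + r < c * N φ + N φ := by omega
      _ = (c + 1) * N φ := by ring
      _ ≤ N φ * N φ := Nat.mul_le_mul_right _ hc
  have h5 : (5 * (c * N φ + r) + h) / 5 = c * N φ + r := by omega
  have h5' : (5 * (c * N φ + r) + h) % 5 = h := by omega
  have hd : (c * N φ + r) / N φ = c := by
    rw [Nat.add_comm, Nat.add_mul_div_right _ _ (by omega), Nat.div_eq_of_lt hr]; simp
  have hm : (c * N φ + r) % N φ = r := by
    rw [Nat.add_comm, Nat.add_mul_mod_self_right, Nat.mod_eq_of_lt hr]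
  refine ⟨?_, by unfold n₂; omega⟩
  unfold slotPair₂
  rw [if_pos (by omega), h5, h5', hd, hm]

/-- Upper hop edges are stage-2 slots (of `h_k` of the column through the site). [folklore] -/
theorem hopUL_mem_S₂ {r j k : ℕ} (hr : r < N φ) (hj : j < N φ) (hk : k < 4) :
    hopUL φ r j k ∈ (placed₂ φ (5 * (J φ r j * N φ + r) + k)).S ∧ 5 * (J φ r j * N φ + r) + k < n₂ φ := by
  obtain ⟨hsp, hlt⟩ := slotPair₂_hop (J_lt hj) hr (show k < 5 by omega)
  refine ⟨?_, hlt⟩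
  rw [placed₂_S hlt, hsp]
  unfold hopSlots' hopSlots
  rw [J_J hj]
  by_cases h0 : k = 0
  · subst h0; rw [if_pos rfl]; simp
  · rw [if_neg h0, if_neg h0, if_neg (by omega)]; simp

/-- Lower hop edges are stage-2 slots (of `h_{k+1}`). [folklore] -/
theorem hopLL_mem_S₂ {r j k : ℕ} (hr : r < N φ) (hj : j < N φ) (hk : k < 4) :
    hopLL φ r j k ∈ (placed₂ φ (5 * (J φ r j * N φ + r) + (k + 1))).S ∧ 5 * (J φ r j * N φ + r) + (k + 1) < n₂ φ := by
  obtain ⟨hsp, hlt⟩ := slotPair₂_hop (J_lt hj) hr (show k + 1 < 5 by omega)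
  refine ⟨?_, hlt⟩
  rw [placed₂_S hlt, hsp]
  unfold hopSlots' hopSlots
  rw [J_J hj, if_neg (show k + 1 ≠ 0 by omega), if_neg (show k + 1 ≠ 0 by omega)]
  by_cases h4 : k + 1 = 4
  · rw [if_pos h4]
    obtain rfl : k = 3 := by omega
    simp
  · rw [if_neg h4]
    simp

/-- Hop edges are stage-2 slots. [folklore] -/
theorem hop_mem_SB₂ {r j k : ℕ} (hr : r < N φ) (hj : j < N φ) (hk : k < 4) :
    hopUL φ r j k ∈ SB₂ φ ∧ hopLL φ r j k ∈ SB₂ φ :=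
  ⟨mem_SB₂.2 ⟨_, (hopUL_mem_S₂ hr hj hk).2, (hopUL_mem_S₂ hr hj hk).1⟩,
    mem_SB₂.2 ⟨_, (hopLL_mem_S₂ hr hj hk).2, (hopLL_mem_S₂ hr hj hk).1⟩⟩

/-- The reversed entry slot `(above r c)ᵒᵖ` is a stage-2 slot (of `h₀`). [folklore] -/
theorem above_swap_mem_SB₂ {r c : ℕ} (hr : r < N φ) (hc : c < N φ) : (above φ r c).swap ∈ SB₂ φ := by
  obtain ⟨hsp, hlt⟩ := slotPair₂_hop hc hr (show 0 < 5 by omega)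
  refine mem_SB₂.2 ⟨_, hlt, ?_⟩
  rw [placed₂_S hlt, hsp]
  unfold hopSlots'
  simp

/-- Hop edges are hop slots; `above` is not. [folklore] -/
theorem isHop_hop {r j k : ℕ} : IsHop φ (hopUL φ r j k) ∧ IsHop φ (hopLL φ r j k) := by
  unfold IsHop hopUL hopLL dlBase; dsimp only; omega

/-- `(above r c)ᵒᵖ` is a chain slot. [folklore] -/
theorem not_isHop_above_swap {r c : ℕ} (hr : r < N φ) (hc : c < N φ) : ¬ IsHop φ (above φ r c).swap := by
  have := above_bounds hr hc; unfold IsHop; simp only [Prod.fst_swap]; omega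

/-- `Uses` is symmetric in the edge. [folklore] -/
theorem uses_swap {l : List ℕ} {e : ℕ × ℕ} : Uses l e.swap ↔ Uses l e := Or.comm

/-- Every stage-2 slot has distinct ends and its increasing form has a stage-2 kind. [folklore] -/
theorem slot2Kind_of_mem_SB₂ {e : ℕ × ℕ} (he : e ∈ SB₂ φ) : e.1 ≠ e.2 ∧ Slot2Kind φ (canon e) := by
  obtain ⟨i, hi, he⟩ := mem_SB₂.1 he
  exact ⟨(slot₂_spec hi he).1, (slot₂_spec hi he).2.2⟩

/-- A stage-2 slot with an end at or above `base1` is increasing. [folklore] -/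
theorem canon_eq_of_mem_SB₂ {e : ℕ × ℕ} (he : e ∈ SB₂ φ) (hh : IsHop φ e) : canon e = e := by
  obtain ⟨i, hi, he⟩ := mem_SB₂.1 he
  exact canon_of_lt (lt_of_mem_S₂_of_base1_le hi he hh)

/-! ### Stage-1 gadgets: offered edges, blocks and specifications -/

/-- The offered edges of a stage-1 gadget are hop edges of a site. [folklore] -/
theorem placed₁_H_cases {i : ℕ} (hi : i < n₁ φ) {x : ℕ × ℕ} (hx : x ∈ (placed₁ φ i).H) :
    i < N φ * N φ ∧ ∃ k < 4, x = hopUL φ (i / N φ) (i % N φ) k ∨ x = hopLL φ (i / N φ) (i % N φ) k := by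
  unfold placed₁ at hx
  split_ifs at hx with h₁ h₂ h₃
  · change x ∈ (dlPlacement _ _ _ _ _ _ _ _).H at hx
    rw [DLPlacement.mem_H_iff] at hx
    obtain ⟨k, hk⟩ := hx
    refine ⟨h₁, k.val, k.isLt, ?_⟩
    rcases hk with rfl | rfl
    · left; simp only [DLPlacement.UL, dlPlacement, hopUL]
    · right; simp only [DLPlacement.LL, dlPlacement, hopLL]
  · exact absurd hx (Finset.notMem_empty _)
  · exact absurd hx (Finset.notMem_empty _)
  · exact absurd hx (Finset.notMem_empty _)

/-- The hop edges of site `(r, j)` are offered by its diamond ladder. [folklore] -/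
theorem hop_mem_H {r j k : ℕ} (hr : r < N φ) (hj : j < N φ) (hk : k < 4) :
    hopUL φ r j k ∈ (placed₁ φ (r * N φ + j)).H ∧ hopLL φ r j k ∈ (placed₁ φ (r * N φ + j)).H := by
  have hidx : r * N φ + j < N φ * N φ := by
    calc r * N φ + j < r * N φ + N φ := by omega
      _ = (r + 1) * N φ := by ring
      _ ≤ N φ * N φ := Nat.mul_le_mul_right _ hr
  have hd : (r * N φ + j) / N φ = r := by
    rw [Nat.add_comm, Nat.add_mul_div_right _ _ (by omega), Nat.div_eq_of_lt hj]; simp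
  have hm : (r * N φ + j) % N φ = j := by
    rw [Nat.add_comm, Nat.add_mul_mod_self_right, Nat.mod_eq_of_lt hj]
  unfold placed₁
  rw [dif_pos hidx]
  constructor
  · show hopUL φ r j k ∈ (dlPlacement _ _ _ _ _ _ _ _).H
    rw [DLPlacement.mem_H_iff]
    refine ⟨⟨k, hk⟩, Or.inl ?_⟩
    simp only [DLPlacement.UL, dlPlacement, hd, hm, hopUL]
  · show hopLL φ r j k ∈ (dlPlacement _ _ _ _ _ _ _ _).H
    rw [DLPlacement.mem_H_iff]
    refine ⟨⟨k, hk⟩, Or.inr ?_⟩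
    simp only [DLPlacement.LL, dlPlacement, hd, hm, hopLL]

/-- The block of the diamond ladder of site `(r, j)`. [folklore] -/
theorem mem_VX_dl {r j : ℕ} (hr : r < N φ) (hj : j < N φ) {v : ℕ} :
    v ∈ (placed₁ φ (r * N φ + j)).VX ↔ dlBase φ r j ≤ v ∧ v < dlBase φ r j + 24 := by
  have hlt : r * N φ + j < N φ * N φ := by
    calc r * N φ + j < r * N φ + N φ := by omega
      _ = (r + 1) * N φ := by ring
      _ ≤ N φ * N φ := Nat.mul_le_mul_right _ hr
  rw [(placed₁ φ _).mem_VX_iff, placed₁_lo, placed₁_size]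
  unfold lo₁ size₁ dlBase
  rw [if_pos hlt, if_pos hlt]

/-- The ends of the hop edges lie in the block of their diamond ladder. [folklore] -/
theorem hop_ends_mem_VX {r j k : ℕ} (hr : r < N φ) (hj : j < N φ) (hk : k < 4) :
    (hopUL φ r j k).1 ∈ (placed₁ φ (r * N φ + j)).VX ∧ (hopUL φ r j k).2 ∈ (placed₁ φ (r * N φ + j)).VX ∧
      (hopLL φ r j k).1 ∈ (placed₁ φ (r * N φ + j)).VX ∧ (hopLL φ r j k).2 ∈ (placed₁ φ (r * N φ + j)).VX := by
  simp only [mem_VX_dl hr hj]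
  unfold hopUL hopLL; dsimp only; omega

/-- **The specification of the diamond ladder of site `(r, j)`**: one slot used and the required
hop edges consistent. [folklore] -/
theorem placed₁_spec_dl {r j : ℕ} (hr : r < N φ) (hj : j < N φ) (U RX : Finset (ℕ × ℕ)) :
    (placed₁ φ (r * N φ + j)).spec U RX ↔ U.card = 1 ∧ ∀ k < 4, (hopUL φ r j k ∈ RX ↔ hopLL φ r j k ∉ RX) := by
  have hlt : r * N φ + j < N φ * N φ := by
    calc r * N φ + j < r * N φ + N φ := by omega
      _ = (r + 1) * N φ := by ring
      _ ≤ N φ * N φ := Nat.mul_le_mul_right _ hr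
  have hd : (r * N φ + j) / N φ = r := by
    rw [Nat.add_comm, Nat.add_mul_div_right _ _ (by omega), Nat.div_eq_of_lt hj]; simp
  have hm : (r * N φ + j) % N φ = j := by
    rw [Nat.add_comm, Nat.add_mul_mod_self_right, Nat.mod_eq_of_lt hj]
  unfold placed₁
  rw [dif_pos hlt]
  change (U.card = 1 ∧ (dlPlacement _ _ _ _ _ _ _ _).Consistent RX) ↔ _
  unfold DLPlacement.Consistent
  refine and_congr_right fun _ => ?_
  rw [Fin.forall_iff]
  refine forall_congr' fun k => forall_congr' fun hk => ?_
  simp only [DLPlacement.UL, DLPlacement.LL, dlPlacement, hd, hm, hopUL, hopLL]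

/-- The specification of a pin: its slot used. [folklore] -/
theorem placed₁_spec_pin {d : ℕ} (hd : d < 2 * N φ) (U RX : Finset (ℕ × ℕ)) :
    (placed₁ φ (N φ * N φ + d)).spec U RX ↔ U.card ≠ 0 := by
  unfold placed₁
  rw [dif_neg (by omega), dif_pos (by omega)]
  exact Iff.rfl

/-- The specification of the unit-clause gadget: its slot used. [folklore] -/
theorem placed₁_spec_clause1 (U RX : Finset (ℕ × ℕ)) :
    (placed₁ φ (N φ * N φ + 2 * N φ)).spec U RX ↔ U.card ≠ 0 := by
  unfold placed₁
  rw [dif_neg (by omega), dif_neg (by omega), dif_pos rfl]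
  exact Iff.rfl

/-- The specification of a three-clause gadget: some slot used. [folklore] -/
theorem placed₁_spec_or3 {t : ℕ} (ht : t < T φ) (U RX : Finset (ℕ × ℕ)) :
    (placed₁ φ (N φ * N φ + 2 * N φ + 1 + t)).spec U RX ↔ U.card ≠ 0 := by
  unfold placed₁
  rw [dif_neg (by omega), dif_neg (by omega), dif_neg (by omega), dif_pos (by unfold n₁; omega)]
  exact Iff.rfl

/-! ### Stage-2 slots over stage 1: chain slots and hop slots -/

/-- **A chain stage-2 slot is a chain edge and no stage-1 slot.** [folklore] -/
theorem SB₂_chain {e : ℕ × ℕ} (he : e ∈ SB₂ φ) (hn : ¬ IsHop φ e) :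
    e.1 ∈ chainV (M φ) ∧ e.2 ∈ chainV (M φ) ∧ ∀ i < n₁ φ, ¬ slotOf ((fam₁ φ).S i) e.1 e.2 := by
  obtain ⟨hne, hK⟩ := slot2Kind_of_mem_SB₂ he
  -- the statement is symmetric in the two ends: prove it for the increasing form
  suffices key : (canon e).1 ∈ chainV (M φ) ∧ (canon e).2 ∈ chainV (M φ) ∧
      ∀ i < n₁ φ, ¬ slotOf ((fam₁ φ).S i) (canon e).1 (canon e).2 by
    rcases canon_eq_or e with hc | hc <;> rw [hc] at key
    · exact key
    · simp only [Prod.fst_swap, Prod.snd_swap] at key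
      exact ⟨key.2.1, key.1, fun i hi hs => key.2.2 i hi (slotOf_comm.1 hs)⟩
  have hn' : ¬ IsHop φ (canon e) := by
    unfold canon
    split_ifs with hlt
    · exact hn
    · intro hh; apply hn
      unfold IsHop at hh ⊢
      simp only [Prod.fst_swap] at hh
      omega
  rcases hK.chain_or_hop with ⟨h1, h2, -, hlt⟩ | ⟨r, j, hr, hj, hH⟩
  · refine ⟨h1, h2, fun i hi hs => ?_⟩
    rcases hs with hs | hs <;> change _ ∈ (placed₁ φ i).S at hs <;> rw [placed₁_S] at hs
    · exact (hK.ne_slot1 hlt (slot1Kind_of_mem hi hs)).1 rfl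
    · exact (hK.ne_slot1 hlt (slot1Kind_of_mem hi hs)).2 rfl
  · obtain ⟨-, k, -, hk⟩ := placed₁_H_cases (site_lt_n₁ hr hj) hH
    exfalso; apply hn'
    rcases hk with hk | hk <;> rw [hk]
    exacts [isHop_hop.1, isHop_hop.2]

/-- **A hop stage-2 slot is a hop edge of a site.** [folklore] -/
theorem SB₂_hop {e : ℕ × ℕ} (he : e ∈ SB₂ φ) (hh : IsHop φ e) :
    ∃ r j k, r < N φ ∧ j < N φ ∧ k < 4 ∧ (e = hopUL φ r j k ∨ e = hopLL φ r j k) := by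
  obtain ⟨-, hK⟩ := slot2Kind_of_mem_SB₂ he
  rw [canon_eq_of_mem_SB₂ he hh] at hK
  rcases hK.chain_or_hop with ⟨h1, -, -, -⟩ | ⟨r, j, hr, hj, hH⟩
  · rw [chainV, mem_range] at h1
    unfold IsHop base1 at hh; omega
  · obtain ⟨-, k, hk, hk'⟩ := placed₁_H_cases (site_lt_n₁ hr hj) hH
    have hd : (r * N φ + j) / N φ = r := by
      rw [Nat.add_comm, Nat.add_mul_div_right _ _ (by omega), Nat.div_eq_of_lt hj]; simp
    have hm : (r * N φ + j) % N φ = j := by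
      rw [Nat.add_comm, Nat.add_mul_mod_self_right, Nat.mod_eq_of_lt hj]
    rw [hd, hm] at hk'
    exact ⟨r, j, k, hr, hj, hk, hk'⟩

/-- A hop stage-2 slot has both ends in a stage-1 block. [folklore] -/
theorem SB₂_hop_VX {e : ℕ × ℕ} (he : e ∈ SB₂ φ) (hh : IsHop φ e) :
    ∃ i < n₁ φ, e.1 ∈ (fam₁ φ).VX i ∧ e.2 ∈ (fam₁ φ).VX i := by
  obtain ⟨r, j, k, hr, hj, hk, he'⟩ := SB₂_hop he hh
  have hV := hop_ends_mem_VX hr hj hk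
  refine ⟨r * N φ + j, site_lt_n₁ hr hj, ?_⟩
  rcases he' with rfl | rfl
  exacts [⟨hV.1, hV.2.1⟩, ⟨hV.2.2.1, hV.2.2.2⟩]

/-- **A hop slot inside the block of a stage-1 gadget is one of its offered edges.** [folklore] -/
theorem inner_hop_mem_H {i : ℕ} (hi : i < n₁ φ) {e : ℕ × ℕ} (he : e ∈ SB₂ φ) (hh : IsHop φ e)
    (h1 : e.1 ∈ (placed₁ φ i).VX) : e ∈ (placed₁ φ i).H := by
  obtain ⟨r, j, k, hr, hj, hk, he'⟩ := SB₂_hop he hh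
  have hV := hop_ends_mem_VX hr hj hk
  have hH := hop_mem_H hr hj hk
  have h1' : e.1 ∈ (placed₁ φ (r * N φ + j)).VX := by rcases he' with rfl | rfl; exacts [hV.1, hV.2.2.1]
  have hsite : i = r * N φ + j := by
    by_contra hne
    exact Finset.disjoint_left.1 (valid₁.VX_disjoint i hi _ (site_lt_n₁ hr hj) hne) h1 h1'
  subst hsite
  rcases he' with rfl | rfl
  exacts [hH.1, hH.2]

/-- Offered edges are hop stage-2 slots. [folklore] -/
theorem H_isHop_mem_SB₂ {i : ℕ} (hi : i < n₁ φ) {x : ℕ × ℕ} (hx : x ∈ (placed₁ φ i).H) : IsHop φ x ∧ x ∈ SB₂ φ := by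
  obtain ⟨hi', k, hk, hx'⟩ := placed₁_H_cases hi hx
  obtain ⟨hr, hj⟩ := dl_site_lt φ hi'
  rcases hx' with rfl | rfl
  exacts [⟨isHop_hop.1, (hop_mem_SB₂ hr hj hk).1⟩, ⟨isHop_hop.2, (hop_mem_SB₂ hr hj hk).2⟩]

/-- The required hop edges inside a stage-1 block are offered edges. [folklore] -/
theorem innerRX_subset {i : ℕ} (hi : i < n₁ φ) {U₂ : Finset (ℕ × ℕ)} (hU₂ : U₂ ⊆ SB₂ φ) :
    innerPart (placed₁ φ i).VX (U₂.filter (IsHop φ)) ⊆ (placed₁ φ i).H := by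
  intro x hx
  rw [mem_innerPart, mem_filter] at hx
  exact inner_hop_mem_H hi (hU₂ hx.1.1) hx.1.2 hx.2.1

/-- **The forbidden hop edges inside a stage-1 block are the offered edges not required.** [folklore] -/
theorem inner_F_eq {i : ℕ} (hi : i < n₁ φ) (U₂ : Finset (ℕ × ℕ)) :
    innerPart (placed₁ φ i).VX ((SB₂ φ \ U₂).filter (IsHop φ)) =
      (placed₁ φ i).H \ innerPart (placed₁ φ i).VX (U₂.filter (IsHop φ)) := by
  ext x
  rw [mem_innerPart, mem_filter, mem_sdiff, mem_sdiff, mem_innerPart, mem_filter]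
  constructor
  · rintro ⟨⟨⟨hS, hU⟩, hh⟩, h1, h2⟩
    exact ⟨inner_hop_mem_H hi hS hh h1, fun h => hU h.1.1⟩
  · rintro ⟨hH, hn⟩
    obtain ⟨hh, hS⟩ := H_isHop_mem_SB₂ hi hH
    obtain ⟨h1, h2, -⟩ := (placed₁ φ i).H_inner x hH
    exact ⟨⟨⟨hS, fun hU => hn ⟨⟨hU, hh⟩, h1, h2⟩⟩, hh⟩, h1, h2⟩

variable (φ) in
/-- **All stage-1 censuses pass** for the stage-1 slot set `U₁`, given the stage-2 slot set `U₂`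
(whose hop part enters the diamond ladders' refined censuses). [folklore] -/
def B₁ (U₁ U₂ : Finset (ℕ × ℕ)) : Prop :=
  ∀ i ∈ range (n₁ φ), (placed₁ φ i).spec (U₁ ∩ (placed₁ φ i).S) (innerPart (placed₁ φ i).VX (U₂.filter (IsHop φ)))

open Classical in
/-- **The refined census of a stage-1 gadget.** [folklore] -/
theorem coverCountRF₁_eq {i : ℕ} (hi : i < n₁ φ) {U₂ : Finset (ℕ × ℕ)} (hU₂ : U₂ ⊆ SB₂ φ) (U₁ : Finset (ℕ × ℕ)) :
    coverCountRF (placed₁ φ i).GX (placed₁ φ i).VX (U₁ ∩ (placed₁ φ i).S)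
        (innerPart (placed₁ φ i).VX (U₂.filter (IsHop φ))) (innerPart (placed₁ φ i).VX ((SB₂ φ \ U₂).filter (IsHop φ))) =
      if (placed₁ φ i).spec (U₁ ∩ (placed₁ φ i).S) (innerPart (placed₁ φ i).VX (U₂.filter (IsHop φ))) then 1 else 0 := by
  rw [inner_F_eq hi]
  exact (placed₁ φ i).census _ inter_subset_right _ (innerRX_subset hi hU₂)

open Classical in
/-- The product of the refined stage-1 censuses is the indicator of `B₁`. [folklore] -/
theorem prod₁_eq {U₂ : Finset (ℕ × ℕ)} (hU₂ : U₂ ⊆ SB₂ φ) (U₁ : Finset (ℕ × ℕ)) :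
    ∏ i ∈ range (n₁ φ), coverCountRF ((fam₁ φ).GX i) ((fam₁ φ).VX i) (U₁ ∩ (fam₁ φ).S i)
        (innerPart ((fam₁ φ).VX i) (U₂.filter (IsHop φ))) (innerPart ((fam₁ φ).VX i) ((SB₂ φ \ U₂).filter (IsHop φ))) =
      if B₁ φ U₁ U₂ then 1 else 0 := by
  show ∏ i ∈ range (n₁ φ), coverCountRF (placed₁ φ i).GX (placed₁ φ i).VX (U₁ ∩ (placed₁ φ i).S)
      (innerPart (placed₁ φ i).VX (U₂.filter (IsHop φ))) (innerPart (placed₁ φ i).VX ((SB₂ φ \ U₂).filter (IsHop φ))) = _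
  rw [prod_congr rfl fun i hi => coverCountRF₁_eq (mem_range.1 hi) hU₂ U₁, prod_boole]
  unfold B₁
  split_ifs <;> rfl

/-! ### The constraints left on the chain -/

variable (φ) in
/-- **The chain constraints** of the slot sets `U₁, U₂` on a chain state `σ`: the path of `σ` uses
every chain slot of `U₂` and every slot of `U₁`, and no other chain slot of `SB₂`, no other slot of
`SB₁`. [folklore] -/
def C₀ (σ : Fin (M φ) → Bool) (U₁ U₂ : Finset (ℕ × ℕ)) : Prop :=
  (∀ e ∈ U₂.filter (fun e => ¬ IsHop φ e) ∪ U₁, Uses (pathOf (M φ) (extB σ)) e) ∧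
    ∀ e ∈ (SB₂ φ \ U₂).filter (fun e => ¬ IsHop φ e) ∪ (SB₁ φ \ U₁), ¬ Uses (pathOf (M φ) (extB σ)) e

/-- Decidability (for the counting arguments). [folklore] -/
noncomputable instance (σ : Fin (M φ) → Bool) (U₁ U₂ : Finset (ℕ × ℕ)) : Decidable (C₀ φ σ U₁ U₂) := by
  unfold C₀; infer_instance

/-- The ends of the chain. [folklore] -/
theorem ends_mem_chainV : (0 : ℕ) ∈ chainV (M φ) ∧ 5 * M φ - 1 ∈ chainV (M φ) := by
  have := M_pos φ
  rw [chainV, mem_range, mem_range]; omega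

/-- The ends of the chain are vertices of `graph₁`. [folklore] -/
theorem ends_mem_verts₁ : (0 : ℕ) ∈ verts₁ φ ∧ 5 * M φ - 1 ∈ verts₁ φ :=
  ⟨GadgetFamily.mem_vertsUpTo_iff.2 (Or.inl ends_mem_chainV.1), GadgetFamily.mem_vertsUpTo_iff.2 (Or.inl ends_mem_chainV.2)⟩

/-- **Stage 2 expanded.** [cite: GareyJohnson1979, §3.2.2] -/
theorem hamCount_graph₂_stage2 : hamCount (graph₂ φ) (verts₂ φ) 0 (5 * M φ - 1) =
    ∑ U₂ ∈ (SB₂ φ).powerset, (if A₂ φ U₂ then 1 else 0) *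
      hamCountRF (graph₁ φ) (verts₁ φ) 0 (5 * M φ - 1) U₂ (SB₂ φ \ U₂) := by
  have h := (valid₂ (φ := φ)).hamCountRF_graphUpTo ends_mem_verts₁.1 ends_mem_verts₁.2 (n₂ φ) le_rfl ∅ ∅
    (by simp) (by simp)
  rw [hamCount_eq]
  change hamCountRF (GadgetFamily.graphUpTo (graph₁ φ) (verts₁ φ) (fam₂ φ) (n₂ φ))
    (GadgetFamily.vertsUpTo (verts₁ φ) (fam₂ φ) (n₂ φ)) 0 (5 * M φ - 1) ∅ ∅ = _
  rw [h]
  refine sum_congr rfl fun U₂ _ => ?_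
  rw [empty_union, empty_union, prod₂_eq]
  rfl

open Classical in
/-- **Stage 1 expanded (refined) and the chain counted.** [cite: GareyJohnson1979, §3.2.2] -/
theorem hamCountRF_graph₁_stage1 {U₂ : Finset (ℕ × ℕ)} (hU₂ : U₂ ⊆ SB₂ φ) :
    hamCountRF (graph₁ φ) (verts₁ φ) 0 (5 * M φ - 1) U₂ (SB₂ φ \ U₂) =
      ∑ U₁ ∈ (SB₁ φ).powerset, (if B₁ φ U₁ U₂ then 1 else 0) *
        (univ.filter fun σ : Fin (M φ) → Bool => C₀ φ σ U₁ U₂).card := by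
  have e1 : U₂.filter (fun e => ¬ IsHop φ e) ∪ U₂.filter (IsHop φ) = U₂ := by
    ext e; simp only [mem_union, mem_filter]; tauto
  have e2 : (SB₂ φ \ U₂).filter (fun e => ¬ IsHop φ e) ∪ (SB₂ φ \ U₂).filter (IsHop φ) = SB₂ φ \ U₂ := by
    ext e; simp only [mem_union, mem_filter]; tauto
  have h := (valid₁ (φ := φ)).hamCountRF_graphUpTo_refined ends_mem_chainV.1 ends_mem_chainV.2 (n₁ φ) le_rfl
    (U₂.filter fun e => ¬ IsHop φ e) ((SB₂ φ \ U₂).filter fun e => ¬ IsHop φ e)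
    (U₂.filter (IsHop φ)) ((SB₂ φ \ U₂).filter (IsHop φ))
    (fun e he => by
      rw [mem_filter] at he
      exact SB₂_chain (hU₂ he.1) he.2)
    (fun e he => by
      rw [mem_filter, mem_sdiff] at he
      exact SB₂_chain he.1.1 he.2)
    (fun x hx => by rw [mem_filter] at hx; exact SB₂_hop_VX (hU₂ hx.1) hx.2)
    (fun x hx => by rw [mem_filter, mem_sdiff] at hx; exact SB₂_hop_VX hx.1.1 hx.2)
  rw [e1, e2] at h
  change hamCountRF (GadgetFamily.graphUpTo (chainG (M φ)) (chainV (M φ)) (fam₁ φ) (n₁ φ))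
    (GadgetFamily.vertsUpTo (chainV (M φ)) (fam₁ φ) (n₁ φ)) 0 (5 * M φ - 1) U₂ (SB₂ φ \ U₂) = _
  rw [h]
  refine sum_congr rfl fun U₁ _ => ?_
  rw [prod₁_eq hU₂ U₁, hamCountRF_chain_eq_card (M_pos φ)]
  rfl

open Classical in
/-- **The count as a double sum of numbers of chain states.** [folklore] -/
theorem hamCount_graph₂_eq_sum_sum : hamCount (graph₂ φ) (verts₂ φ) 0 (5 * M φ - 1) =
    ∑ U₂ ∈ (SB₂ φ).powerset, ∑ U₁ ∈ (SB₁ φ).powerset,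
      (univ.filter fun σ : Fin (M φ) → Bool => A₂ φ U₂ ∧ B₁ φ U₁ U₂ ∧ C₀ φ σ U₁ U₂).card := by
  rw [hamCount_graph₂_stage2]
  refine sum_congr rfl fun U₂ hU₂ => ?_
  rw [hamCountRF_graph₁_stage1 (mem_powerset.1 hU₂), mul_sum]
  refine sum_congr rfl fun U₁ _ => ?_
  by_cases hA : A₂ φ U₂ <;> by_cases hB : B₁ φ U₁ U₂ <;> simp [hA, hB]

open Classical in
/-- **The count as a sum over chain states** of numbers of admissible pairs of slot sets. [folklore] -/
theorem hamCount_graph₂_eq_sum_states : hamCount (graph₂ φ) (verts₂ φ) 0 (5 * M φ - 1) =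
    ∑ σ : Fin (M φ) → Bool, (((SB₂ φ).powerset ×ˢ (SB₁ φ).powerset).filter
      fun u => A₂ φ u.1 ∧ B₁ φ u.2 u.1 ∧ C₀ φ σ u.2 u.1).card := by
  rw [hamCount_graph₂_eq_sum_sum]
  have h := (sum_product' (SB₂ φ).powerset (SB₁ φ).powerset
    (fun U₂ U₁ => (univ.filter fun σ : Fin (M φ) → Bool => A₂ φ U₂ ∧ B₁ φ U₁ U₂ ∧ C₀ φ σ U₁ U₂).card)).symm
  rw [h]
  simp only [card_filter]
  exact sum_comm

/-! ### The canonical slot sets of a chain state -/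

variable (φ) in
/-- **The stage-1 slots used by the path of `σ`.** [folklore] -/
noncomputable def U₁of (σ : Fin (M φ) → Bool) : Finset (ℕ × ℕ) :=
  (SB₁ φ).filter fun e => Uses (pathOf (M φ) (extB σ)) e

variable (φ) in
/-- **Selection of a hop edge by `σ`**: decoding the site `(r, j)` from the edge, an upper hop edge is
selected iff the entry slot `above r c` of the column `c = J r j` through the site is NOT used, a lower
one iff it is. [folklore] -/
def HopSel (σ : Fin (M φ) → Bool) (e : ℕ × ℕ) : Prop :=
  (e.2 = e.1 + 1) ↔ ¬ Uses (pathOf (M φ) (extB σ))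
    (above φ ((e.1 - base1 φ) / 24 / N φ) (J φ ((e.1 - base1 φ) / 24 / N φ) ((e.1 - base1 φ) / 24 % N φ)))

variable (φ) in
/-- **Selection of a stage-2 slot by `σ`**: hop edges as above, chain slots iff used. [folklore] -/
def Sel (σ : Fin (M φ) → Bool) (e : ℕ × ℕ) : Prop :=
  if IsHop φ e then HopSel φ σ e else Uses (pathOf (M φ) (extB σ)) e

/-- Decidability (for the counting arguments). [folklore] -/
instance (σ : Fin (M φ) → Bool) (e : ℕ × ℕ) : Decidable (HopSel φ σ e) := by unfold HopSel; infer_instance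

/-- Decidability (for the counting arguments). [folklore] -/
instance (σ : Fin (M φ) → Bool) (e : ℕ × ℕ) : Decidable (Sel φ σ e) := by unfold Sel; infer_instance

variable (φ) in
/-- **The stage-2 slots selected by `σ`.** [folklore] -/
noncomputable def U₂of (σ : Fin (M φ) → Bool) : Finset (ℕ × ℕ) :=
  (SB₂ φ).filter (Sel φ σ)

variable (φ) in
/-- **The collapsed constraint on a chain state**: its canonical slot sets pass every census. [folklore] -/
def Φ₁ (σ : Fin (M φ) → Bool) : Prop :=
  A₂ φ (U₂of φ σ) ∧ B₁ φ (U₁of φ σ) (U₂of φ σ)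

/-- Membership in `U₁of`. [folklore] -/
theorem mem_U₁of {σ : Fin (M φ) → Bool} {e : ℕ × ℕ} : e ∈ U₁of φ σ ↔ e ∈ SB₁ φ ∧ Uses (pathOf (M φ) (extB σ)) e :=
  mem_filter

/-- Membership in `U₂of`. [folklore] -/
theorem mem_U₂of {σ : Fin (M φ) → Bool} {e : ℕ × ℕ} : e ∈ U₂of φ σ ↔ e ∈ SB₂ φ ∧ Sel φ σ e :=
  mem_filter

/-- `U₁of ⊆ SB₁`. [folklore] -/
theorem U₁of_subset (σ : Fin (M φ) → Bool) : U₁of φ σ ⊆ SB₁ φ := filter_subset _ _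

/-- `U₂of ⊆ SB₂`. [folklore] -/
theorem U₂of_subset (σ : Fin (M φ) → Bool) : U₂of φ σ ⊆ SB₂ φ := filter_subset _ _

/-- Selection of a chain slot: used. [folklore] -/
theorem sel_of_not_isHop {σ : Fin (M φ) → Bool} {e : ℕ × ℕ} (hn : ¬ IsHop φ e) :
    Sel φ σ e ↔ Uses (pathOf (M φ) (extB σ)) e := by
  unfold Sel; rw [if_neg hn]

/-- Selection of an upper hop edge. [folklore] -/
theorem sel_hopUL {σ : Fin (M φ) → Bool} {r j k : ℕ} (hj : j < N φ) (hk : k < 4) :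
    Sel φ σ (hopUL φ r j k) ↔ ¬ Uses (pathOf (M φ) (extB σ)) (above φ r (J φ r j)) := by
  have hd : (r * N φ + j) / N φ = r := by
    rw [Nat.add_comm, Nat.add_mul_div_right _ _ (by omega), Nat.div_eq_of_lt hj]; simp
  have hm : (r * N φ + j) % N φ = j := by
    rw [Nat.add_comm, Nat.add_mul_mod_self_right, Nat.mod_eq_of_lt hj]
  have hB : (dlBase φ r j + (8 + 4 * k) - base1 φ) / 24 = r * N φ + j := by unfold dlBase; omega
  unfold Sel
  rw [if_pos isHop_hop.1]
  unfold HopSel hopUL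
  dsimp only
  rw [hB, hd, hm, iff_true_left (show dlBase φ r j + (9 + 4 * k) = dlBase φ r j + (8 + 4 * k) + 1 by omega)]

/-- Selection of a lower hop edge. [folklore] -/
theorem sel_hopLL {σ : Fin (M φ) → Bool} {r j k : ℕ} (hj : j < N φ) (hk : k < 4) :
    Sel φ σ (hopLL φ r j k) ↔ Uses (pathOf (M φ) (extB σ)) (above φ r (J φ r j)) := by
  have hd : (r * N φ + j) / N φ = r := by
    rw [Nat.add_comm, Nat.add_mul_div_right _ _ (by omega), Nat.div_eq_of_lt hj]; simp
  have hm : (r * N φ + j) % N φ = j := by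
    rw [Nat.add_comm, Nat.add_mul_mod_self_right, Nat.mod_eq_of_lt hj]
  have hB : (dlBase φ r j + (8 + 4 * k) - base1 φ) / 24 = r * N φ + j := by unfold dlBase; omega
  unfold Sel
  rw [if_pos isHop_hop.2]
  unfold HopSel hopLL
  dsimp only
  rw [hB, hd, hm, iff_false_left (show ¬ dlBase φ r j + (10 + 4 * k) = dlBase φ r j + (8 + 4 * k) + 1 by omega), not_not]

/-- **The canonical slot sets satisfy the chain constraints.** [folklore] -/
theorem C₀_of (σ : Fin (M φ) → Bool) : C₀ φ σ (U₁of φ σ) (U₂of φ σ) := by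
  constructor
  · intro e he
    rcases mem_union.1 he with he | he
    · obtain ⟨he, hn⟩ := mem_filter.1 he
      exact (sel_of_not_isHop hn).1 (mem_U₂of.1 he).2
    · exact (mem_U₁of.1 he).2
  · intro e he hu
    rcases mem_union.1 he with he | he
    · obtain ⟨he, hn⟩ := mem_filter.1 he
      obtain ⟨heS, hne⟩ := mem_sdiff.1 he
      exact hne (mem_U₂of.2 ⟨heS, (sel_of_not_isHop hn).2 hu⟩)
    · obtain ⟨heS, hne⟩ := mem_sdiff.1 he
      exact hne (mem_U₁of.2 ⟨heS, hu⟩)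

/-! ### The hop part of an admissible `U₂` is forced -/

/-- Exactly one of two distinct elements in a set, from the cardinality of the intersection. [folklore] -/
theorem xor_of_card_inter_pair {U : Finset (ℕ × ℕ)} {a b : ℕ × ℕ} (hab : a ≠ b) (h : (U ∩ {a, b}).card = 1) :
    a ∈ U ↔ b ∉ U := by
  obtain ⟨x, hx⟩ := card_eq_one.1 h
  have hxm : x ∈ U ∩ {a, b} := by rw [hx]; exact mem_singleton_self _
  rw [mem_inter, mem_insert, mem_singleton] at hxm
  have ha : a ∈ U → x = a := fun ha' => by
    have : a ∈ U ∩ {a, b} := mem_inter.2 ⟨ha', by simp⟩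
    rw [hx, mem_singleton] at this; exact this.symm
  have hb : b ∈ U → x = b := fun hb' => by
    have : b ∈ U ∩ {a, b} := mem_inter.2 ⟨hb', by simp⟩
    rw [hx, mem_singleton] at this; exact this.symm
  constructor
  · intro ha' hb'; exact hab ((ha ha').symm.trans (hb hb'))
  · intro hb'
    rcases hxm.2 with h' | h'
    · rw [← h']; exact hxm.1
    · exact absurd (h' ▸ hxm.1) hb'

/-- The two slots of a hop ladder differ. [folklore] -/
theorem hopSlots_ne {c r h : ℕ} (hc : c < N φ) (hr : r < N φ) (hh : h < 5) : (hopSlots' φ c r h).1 ≠ (hopSlots' φ c r h).2 :=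
  fun heq => (hopSlots'_ok hc hr hh).2.2.1 (congrArg Prod.fst heq)

/-- A chain slot is in an admissible `U₂` iff the path uses it. [folklore] -/
theorem chain_mem_iff {σ : Fin (M φ) → Bool} {U₁ U₂ : Finset (ℕ × ℕ)} (hC : C₀ φ σ U₁ U₂)
    {e : ℕ × ℕ} (he : e ∈ SB₂ φ) (hn : ¬ IsHop φ e) : e ∈ U₂ ↔ Uses (pathOf (M φ) (extB σ)) e := by
  constructor
  · intro heU; exact hC.1 e (mem_union_left _ (mem_filter.2 ⟨heU, hn⟩))
  · intro hu; by_contra hne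
    exact hC.2 e (mem_union_left _ (mem_filter.2 ⟨mem_sdiff.2 ⟨he, hne⟩, hn⟩)) hu

/-- **The hop edges of an admissible `U₂` are forced**: at site `(r, j)`, on the column `c = J r j`,
the upper hop edges are in `U₂` iff the entry slot `above r c` is unused, the lower ones iff it is
used (exclusive-or ladders `h₀ … h₃` and the consistency of the diamond ladder). [cite: LiskiewiczOgiharaToda2003, §3, Fig. 2 (b)] -/
theorem hop_determined {σ : Fin (M φ) → Bool} {U₁ U₂ : Finset (ℕ × ℕ)} (hA : A₂ φ U₂) (hB : B₁ φ U₁ U₂)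
    (hC : C₀ φ σ U₁ U₂) {r j : ℕ} (hr : r < N φ) (hj : j < N φ) {k : ℕ} (hk : k < 4) :
    (hopUL φ r j k ∈ U₂ ↔ ¬ Uses (pathOf (M φ) (extB σ)) (above φ r (J φ r j))) ∧
      (hopLL φ r j k ∈ U₂ ↔ Uses (pathOf (M φ) (extB σ)) (above φ r (J φ r j))) := by
  have hc : J φ r j < N φ := J_lt hj
  have hJ : J φ r (J φ r j) = j := J_J hj
  -- consistency of the diamond ladder of the site
  have hcons : ∀ k < 4, (hopUL φ r j k ∈ U₂ ↔ hopLL φ r j k ∉ U₂) := by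
    have h := hB (r * N φ + j) (mem_range.2 (site_lt_n₁ hr hj))
    rw [placed₁_spec_dl hr hj] at h
    intro k hk
    have hV := hop_ends_mem_VX (φ := φ) hr hj hk
    have hh := isHop_hop (φ := φ) (r := r) (j := j) (k := k)
    have := h.2 k hk
    simp only [mem_innerPart, mem_filter, hh.1, hh.2, hV.1, hV.2.1, hV.2.2.1, hV.2.2.2, and_true] at this
    exact this
  -- the exclusive-or ladders of the column through the site
  have hxor : ∀ h < 5, ((hopSlots' φ (J φ r j) r h).1 ∈ U₂ ↔ (hopSlots' φ (J φ r j) r h).2 ∉ U₂) := by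
    intro h hh
    obtain ⟨hsp, hlt⟩ := slotPair₂_hop hc hr hh
    have h1 := hA _ (mem_range.2 hlt)
    rw [placed₂_S hlt, hsp] at h1
    exact xor_of_card_inter_pair (hopSlots_ne hc hr hh) h1
  have hab := chain_mem_iff hC (above_swap_mem_SB₂ hr hc) (not_isHop_above_swap hr hc)
  rw [uses_swap] at hab
  have x0 := hxor 0 (by omega)
  have x1 := hxor 1 (by omega)
  have x2 := hxor 2 (by omega)
  have x3 := hxor 3 (by omega)
  norm_num [hopSlots', hopSlots, hJ] at x0 x1 x2 x3
  -- propagate down the column: `step` across an exclusive-or ladder, `step'` across a diamond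
  have step : ∀ {A B v : Prop}, (A ↔ ¬ B) → (A ↔ v) → (B ↔ ¬ v) := fun hx ha => (iff_not_comm.1 hx).trans (not_congr ha)
  have step' : ∀ {A B v : Prop}, (A ↔ ¬ B) → (A ↔ ¬ v) → (B ↔ v) := fun hx ha =>
    (iff_not_comm.1 hx).trans ((not_congr ha).trans not_not)
  have u0 := step x0 hab
  have l0 := step' (hcons 0 (by omega)) u0
  have u1 := step x1 l0
  have l1 := step' (hcons 1 (by omega)) u1
  have u2 := step x2 l1
  have l2 := step' (hcons 2 (by omega)) u2
  have u3 := step x3 l2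
  have l3 := step' (hcons 3 (by omega)) u3
  rcases (show k = 0 ∨ k = 1 ∨ k = 2 ∨ k = 3 by omega) with rfl | rfl | rfl | rfl
  exacts [⟨u0, l0⟩, ⟨u1, l1⟩, ⟨u2, l2⟩, ⟨u3, l3⟩]

/-- **For each chain state at most one admissible pair of slot sets**: the canonical one, and it is
admissible iff `Φ₁`. [folklore] -/
theorem key (σ : Fin (M φ) → Bool) {U₂ U₁ : Finset (ℕ × ℕ)} (hU₂ : U₂ ⊆ SB₂ φ) (hU₁ : U₁ ⊆ SB₁ φ) :
    (A₂ φ U₂ ∧ B₁ φ U₁ U₂ ∧ C₀ φ σ U₁ U₂) ↔ (U₂ = U₂of φ σ ∧ U₁ = U₁of φ σ ∧ Φ₁ φ σ) := by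
  constructor
  · rintro ⟨hA, hB, hC⟩
    have e1 : U₁ = U₁of φ σ := by
      ext e; rw [mem_U₁of]
      constructor
      · intro he; exact ⟨hU₁ he, hC.1 e (mem_union_right _ he)⟩
      · rintro ⟨heS, hu⟩; by_contra hne
        exact hC.2 e (mem_union_right _ (mem_sdiff.2 ⟨heS, hne⟩)) hu
    have e2 : U₂ = U₂of φ σ := by
      ext e; rw [mem_U₂of]
      by_cases heS : e ∈ SB₂ φ
      · by_cases hh : IsHop φ e
        · obtain ⟨r, j, k, hr, hj, hk, rfl | rfl⟩ := SB₂_hop heS hh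
          · rw [sel_hopUL hj hk, (hop_determined hA hB hC hr hj hk).1]; simp [heS]
          · rw [sel_hopLL hj hk, (hop_determined hA hB hC hr hj hk).2]; simp [heS]
        · rw [chain_mem_iff hC heS hh, sel_of_not_isHop hh]; simp [heS]
      · constructor
        · intro he; exact absurd (hU₂ he) heS
        · rintro ⟨h, -⟩; exact absurd h heS
    subst e1; subst e2
    exact ⟨rfl, rfl, hA, hB⟩
  · rintro ⟨rfl, rfl, hΦ⟩
    exact ⟨hΦ.1, hΦ.2, C₀_of σ⟩

open Classical in
/-- The admissible pairs of slot sets of a chain state. [folklore] -/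
theorem filter_pairs_eq (σ : Fin (M φ) → Bool) :
    (((SB₂ φ).powerset ×ˢ (SB₁ φ).powerset).filter fun u => A₂ φ u.1 ∧ B₁ φ u.2 u.1 ∧ C₀ φ σ u.2 u.1) =
      if Φ₁ φ σ then {(U₂of φ σ, U₁of φ σ)} else ∅ := by
  ext ⟨U₂, U₁⟩
  rw [mem_filter, mem_product, mem_powerset, mem_powerset]
  constructor
  · rintro ⟨⟨h2, h1⟩, h⟩
    obtain ⟨rfl, rfl, hΦ⟩ := (key σ h2 h1).1 h
    rw [if_pos hΦ]; exact mem_singleton_self _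
  · intro h
    split_ifs at h with hΦ
    · rw [mem_singleton] at h
      obtain ⟨rfl, rfl⟩ := Prod.mk.inj h
      exact ⟨⟨U₂of_subset σ, U₁of_subset σ⟩, (key σ (U₂of_subset σ) (U₁of_subset σ)).2 ⟨rfl, rfl, hΦ⟩⟩
    · exact absurd h (notMem_empty _)

open Classical in
/-- **The number of Hamiltonian paths of the graph of `φ` is the number of chain states whose
canonical slot sets pass every census.** [cite: LiskiewiczOgiharaToda2003, §3 (Lemma 4)] -/
theorem hamCount_graph₂_eq_card :
    hamCount (graph₂ φ) (verts₂ φ) 0 (5 * M φ - 1) = (univ.filter (Φ₁ φ)).card := by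
  rw [hamCount_graph₂_eq_sum_states, card_filter]
  refine sum_congr rfl fun σ _ => ?_
  rw [filter_pairs_eq σ]
  split_ifs <;> simp

end LOTReduction

end Literature.Combinatorics.SimpleGraph
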